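import Summits.ResolutionOfSingularities.ResolutionOfSingularities.Theorems.HilbertSamuelEliminationSigmaMaxModificationsCorridor3WLadderIsoInsepE2NearOnLine
import Summits.ResolutionOfSingularities.ResolutionOfSingularities.Theorems.HilbertSamuelEliminationSigmaMaxModificationsCorridor3WLadderIsoInsepE2NearCubic
import Literature.AlgebraicGeometry.Resolution.RegularLocalRingsNormal
import HarnessLib

/-!
# [OURS · L1 W4.2] E2 chart calculus, brick 12: THE CUBIC CONE ON THE TOWER — after an E2 stage, the cubic form `F₃` of
# `h = ĉ(x² + λ̂y²) + F₃(x,y,z,w)` (all terms of order `≥ 3`, coefficients in `R`) has its cone `F₃(c/c_j)` vanishing at the next point,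
# equivalently the restricted cubic `g₃ = F₃(0,0,z,w)` does (crux chain w42, cell k2 `T3insep` = `stub_isoInsepTower`;
# `--supports stmt-ResolutionOfSingularities-19249`)

OURS (cell res-hironaka, slot W4.2, seat res-D-pv-042; OWN OBJECT TUO 18:19Z, (N3) continuation); NOT a statement of [Hironaka2017]
nor of [CossartJannsenSaito2020] / [CossartPiltant2008]. AI-drafted, weaker than expert review. PROOF file, def-free, fact-free.

* `exists_e2StepPresentation_cubic` — brick 10 `exists_e2StepPresentation_onLine` with, in addition, a cubic form `F` over `R` with
  `F(c) = h − ĉ(c₀² + λ̂c₁²)` (Literature `exists_isHomogeneous_eval_eq_of_mem_pow`), the identity `h′ = ĉ(u² + λ̂v²) + (c_j/1)·F(c/c_j)`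
  (brick 11 `strictTransform_eq_of_cubicForm`), **`F(c/c_j) ∈ 𝔔`** (brick 11 (N3a): nearness read on the cubic cone) and
  `F(0, 0, c₂/c_j, c₃/c_j) ∈ 𝔔` (the restricted cubic `g₃` vanishes at the point of the line). Start datum of (N3b) and of RC/NJ.
-/

noncomputable section

set_option linter.dupNamespace false

open scoped Classical
open CategoryTheory AlgebraicGeometry TopologicalSpace IsLocalRing
open Literature.RingTheory.HilbertSamuel Literature.AlgebraicGeometry.Resolution Literature.AlgebraicGeometry.CossartJannsenSaito2020
open Summit.ResolutionOfSingularities.ResolutionOfSingularities.Theorems.CampaignW42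
open Summit.ResolutionOfSingularities.ResolutionOfSingularities.Theorems.SigmaMaxModificationsCorridor3
open Summit.ResolutionOfSingularities.ResolutionOfSingularities.Cruxes.SigmaMaxModifications.IdeasL1Idea2R4 (IsIsoPointTower)
open Summit.ResolutionOfSingularities.ResolutionOfSingularities.Cruxes.SigmaMaxModifications.IdeasL1C5 (IsInsepStage)

namespace Summit.ResolutionOfSingularities.ResolutionOfSingularities.Cruxes.SigmaMaxModifications.IdeasL1C6

/-- **THE CUBIC CONE ON THE TOWER.** Along an isolated E3 point tower over a maximal origin of characteristic two, at an E2 stage `n`: the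
data of `exists_e2StepPresentation_onLine` (E2-adapted `R, c, σ, h`, chart `j ∉ {0,1}`, the prime `𝔔 ∋ c₀/c_j, c₁/c_j` of the next point,
the strict transform `h′` of order two at `𝔔`) together with a CUBIC FORM `F` over `R` with `F(c) = h − ĉ(c₀² + λ̂c₁²)`, the identity
`h′ = ĉ(u² + λ̂v²) + (c_j/1)·F(c/c_j)` and **`F(c/c_j) ∈ 𝔔`, `F(0,0,c₂/c_j,c₃/c_j) ∈ 𝔔`**: the cubic cone of `h` passes through the next
point of the line. [OURS · L1 W4.2 · k2 · E2 chart calculus, brick 12] [folklore] -/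
theorem exists_e2StepPresentation_cubic {N : ℕ} {ν : ℕ → ℕ} {T : BlowupTower.{0}} {pt : ∀ n, T.X n}
    (hO : IsMaximalOrigin 2 N ν (T.X 0) (pt 0)) (hT : IsIsoPointTower N ν T pt) (n : ℕ) (hE : IsE2Stage T pt n) :
    ∃ (R : Type) (_ : CommRing R) (_ : IsRegularLocalRing R) (c : Fin 4 → R) (σ : R →+* (T.X n).presheaf.stalk (pt n))
      (h cc lam : R) (hpt : (T.π n) (pt (n + 1)) = pt n),
      (maximalIdeal R).spanFinrank = 4 ∧ Ideal.span (Set.range c) = maximalIdeal R ∧ Function.Surjective σ ∧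
      RingHom.ker σ = Ideal.span {h} ∧ h ∈ maximalIdeal R ^ 2 ∧ h ∉ maximalIdeal R ^ 3 ∧
      cc ∉ maximalIdeal R ∧ (∀ u : R, u ^ 2 - lam ∉ maximalIdeal R) ∧
      h - cc * (c 0 ^ 2 + lam * c 1 ^ 2) ∈ maximalIdeal R ^ 3 ∧ (2 : R) ∈ maximalIdeal R ∧
    ∃ (j : Fin 4) (𝔔 : PrimeSpectrum (blowupAlgebra (Ideal.span (Set.range c)) (c j)))
      (h' : blowupAlgebra (Ideal.span (Set.range c)) (c j))
      (σ' : Localization.AtPrime 𝔔.asIdeal →+* (T.X (n + 1)).presheaf.stalk (pt (n + 1))),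
      algebraMap R _ h = algebraMap R _ (c j) ^ 2 * h' ∧
      Prime (algebraMap R (blowupAlgebra (Ideal.span (Set.range c)) (c j)) (c j)) ∧
      ¬ algebraMap R (blowupAlgebra (Ideal.span (Set.range c)) (c j)) (c j) ∣ h' ∧
      𝔔.asIdeal.comap (algebraMap R _) = maximalIdeal R ∧
      h' ∈ 𝔔.asIdeal ∧
      IsRegularLocalRing (Localization.AtPrime 𝔔.asIdeal) ∧
      Function.Surjective σ' ∧
      RingHom.ker σ' = Ideal.span {algebraMap _ (Localization.AtPrime 𝔔.asIdeal) h'} ∧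
      (∀ r : R, σ' (algebraMap _ (Localization.AtPrime 𝔔.asIdeal)
        (algebraMap R (blowupAlgebra (Ideal.span (Set.range c)) (c j)) r)) =
          ((T.π n).stalkMap (pt (n + 1))).hom (((T.X n).presheaf.stalkCongr (.of_eq hpt)).inv (σ r))) ∧
      (∀ k : Fin 4, σ' (algebraMap _ (Localization.AtPrime 𝔔.asIdeal) (blowupAlgebra.frac c j k)) *
        ((T.π n).stalkMap (pt (n + 1))).hom (((T.X n).presheaf.stalkCongr (.of_eq hpt)).inv (σ (c j))) =
          ((T.π n).stalkMap (pt (n + 1))).hom (((T.X n).presheaf.stalkCongr (.of_eq hpt)).inv (σ (c k)))) ∧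
      ((T.π n).stalkMap (pt (n + 1))).hom (((T.X n).presheaf.stalkCongr (.of_eq hpt)).inv (σ (c j))) ∈
        nonZeroDivisors ((T.X (n + 1)).presheaf.stalk (pt (n + 1))) ∧
      stalkIdeal ((T.centreIdeal n).comap (T.π n)) (pt (n + 1)) =
        Ideal.span {((T.π n).stalkMap (pt (n + 1))).hom
          (((T.X n).presheaf.stalkCongr (.of_eq hpt)).inv (σ (c j)))} ∧
      algebraMap _ (Localization.AtPrime 𝔔.asIdeal) h' ∈ maximalIdeal (Localization.AtPrime 𝔔.asIdeal) ^ 2 ∧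
      algebraMap _ (Localization.AtPrime 𝔔.asIdeal) h' ∉ maximalIdeal (Localization.AtPrime 𝔔.asIdeal) ^ 3 ∧
      blowupAlgebra.frac c j 0 ∈ 𝔔.asIdeal ∧ blowupAlgebra.frac c j 1 ∈ 𝔔.asIdeal ∧ j ≠ 0 ∧ j ≠ 1 ∧
    ∃ F : MvPolynomial (Fin 4) R, F.IsHomogeneous 3 ∧ MvPolynomial.eval c F = h - cc * (c 0 ^ 2 + lam * c 1 ^ 2) ∧
      h' = algebraMap R _ cc * (blowupAlgebra.frac c j 0 ^ 2 + algebraMap R _ lam * blowupAlgebra.frac c j 1 ^ 2) +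
        algebraMap R _ (c j) * MvPolynomial.aeval (blowupAlgebra.frac c j) F ∧
      MvPolynomial.aeval (blowupAlgebra.frac c j) F ∈ 𝔔.asIdeal ∧
      MvPolynomial.aeval (fun k => if k = 0 ∨ k = 1 then 0 else blowupAlgebra.frac c j k) F ∈ 𝔔.asIdeal := by
  obtain ⟨R, _, _, c, σ, h, cc, lam, hpt, h4, hc, hσ, hker, hh2, hh3, hcc, hlam, hshape, h2, j, 𝔔, h', σ', hh', hprime, hndvd,
    h𝔔, hh'𝔔, hreg, hσ', hker', hcompat, hfrac, hnzd, hcentre, hh'2, hh'3, hfr0, hfr1, hj0, hj1⟩ :=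
    exists_e2StepPresentation_onLine hO hT n hE
  -- the cubic form
  obtain ⟨F, hF, hFh⟩ := exists_isHomogeneous_eval_eq_of_mem_pow c hc hshape
  have heq := E2Chart.strictTransform_eq_of_cubicForm c hF hFh j hh'
  have hcj𝔔 : algebraMap R (blowupAlgebra (Ideal.span (Set.range c)) (c j)) (c j) ∈ 𝔔.asIdeal := by
    have : c j ∈ 𝔔.asIdeal.comap (algebraMap R (blowupAlgebra (Ideal.span (Set.range c)) (c j))) := by
      rw [h𝔔, ← hc]; exact Ideal.subset_span (Set.mem_range_self j)
    exact this
  have hG : MvPolynomial.aeval (blowupAlgebra.frac c j) F ∈ 𝔔.asIdeal :=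
    (E2Chart.strictTransform_mem_sq_iff_coneTransform_mem h4 c hc hF hFh j 𝔔.asIdeal hcj𝔔 hfr0 hfr1 hh').mp hh'2
  have hG0 := (E2Chart.coneTransform_mem_iff_lineRestriction_mem c j 𝔔.asIdeal hfr0 hfr1 F).mp hG
  exact ⟨R, inferInstance, inferInstance, c, σ, h, cc, lam, hpt, h4, hc, hσ, hker, hh2, hh3, hcc, hlam, hshape, h2, j, 𝔔, h', σ',
    hh', hprime, hndvd, h𝔔, hh'𝔔, hreg, hσ', hker', hcompat, hfrac, hnzd, hcentre, hh'2, hh'3, hfr0, hfr1, hj0, hj1,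
    F, hF, hFh, heq, hG, hG0⟩

end Summit.ResolutionOfSingularities.ResolutionOfSingularities.Cruxes.SigmaMaxModifications.IdeasL1C6

end
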